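/-
Copyright: the b2b-balaban T⁴-continuum CRUX team, row NE7b OWNER lineage `t4-ne7b-p1` (gen 141). Project licence.
-/
import Summits.QuantumFields.BalabanUV.T4Continuum.Spine.NE7b.SupWhitenedObservableSixthMoment

/-!
# THE SIXTH CENTRED MOMENT OF A GRADIENT COMPONENT UNDER `N(0,AAᵀ)` — THE LETTER `M₆` OF THE FOURTH-CUMULANT TREE BOUND DISCHARGED
# (SCOPING (d13)(2); (496)–(499) carried `M₆` as a hypothesis).  (423)'s Gaussian-regulator domination extends from `‖U′‖⁴` to `‖U′‖⁶`
# (`S⁶ ≤ (45∕4)δ⁻⁶e^{2δS}`), so the raw tilted sixth moment of `‖U′(ω+ψ)‖` is finite for every background under the regulator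
# `(2κ₀(1+τ)+4δ)γ_op ≤ θ < 1`; pushed to the whitened coordinates (`|U′φe_v| ≤ ‖U′φ‖`) it is the integrability letter `e·g_v⁶ ∈ L¹(N(0,I))`
# of (504), whose generic sixth-moment bound with `L = κ₂√γ_op` ((464) `whitened_obs_hasFDerivAt`) then reads, in (461)∕(496)'s Gibbs format,
#   `∫(F_v − E_νF_v)⁶dν ≤ 50κ₂⁶γ_op³∕(1 − λγ_op)³`,   `(F_v − c)⁶ ∈ L¹(ν)` for every constant `c`
# — EXACTLY the hypotheses `hM6`, `hI6` of (497) `whitened_fourth_cumulant_tree`, (498), (499): the cumulant piece of `∂⁴W`'s kernel letter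
# is now letter-free but for the geometry (row NE7b, node U5c; (504), (503), (465), (464), (458), (457), (423) BY NAME; [folklore] +
# [cite: BrascampLieb1976, Thm 4.1] through (422))

Cell `pub-balaban`, sub-cell `t4`, spine estimate NE7b (`T4WeightBudget.RelWeightBound`; the cell's OWN estimate — NOT PRINTED in
[Bałaban 1983–89], NOT PROVED).  Crux-route work under `Spine/NE7b/` by the row OWNER (`t4-ne7b-p1` gen 141, file (505)) under FREEZE
(0)'s crux-prover clause; NOTHING of Bałaban's is named as a Lean object, valued or asserted; no `T4Continuum/Support` leaf typed; no
`def`, no notation; zero `sorry`.  Imports (BY NAME): the OWNER's (504) `…SupWhitenedObservableSixthMoment` (`obs_sixth_moment_le`,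
`sixth_pow_sub_le`; through it (464) `whitened_obs_hasFDerivAt`, `whitened_obs_moments`, (458) `whitened_exp_integrable`, `posSemidef_AAT`,
(457) `whitened_tilted_eq_gauss`, `whitened_integrable_lebesgue`, `whitened_integrable_iff`, (423)'s regulator imports `neg_block_le`,
`sum_add_sq_le`, `integrable_exp_half_sq_on`, `mul_opBound_le_of_le`).

WHAT IS PROVED ([folklore]):
* §1 `pow6_le_exp`, `block_moment6_pointwise`, **`integrable_block_moment6`** (`e^{−U(ω+ψ)}‖U′(ω+ψ)‖⁶ ∈ L¹(N(0,Γ))`, any `Γ` under the regulator).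
* §2 `whitened_obs_moment6` (`e·g_v⁶ ∈ L¹(N(0,I))`), **`whitened_sixth_power_integrable`** (`(F_v − c)⁶ ∈ L¹(ν)`), THE END
  **`whitened_sixth_moment_gibbs`** (`∫(F_v − E_νF_v)⁶dν ≤ 50κ₂⁶γ_op³∕(1−λγ_op)³`); §3 toy.

HONEST (what this is NOT).  A moment letter; plugging it into (497)–(499) (replacing `M₆` by `50κ₂⁶γ_op³∕(1−λγ_op)³`) is bookkeeping for
the order-4 assembly; the three-point pieces and the cumulant FORM of `∂⁴W` are NOT typed.  Scalar skeleton ((A3), NC-NE7b-α UNRULED);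
nothing of Bałaban's asserted.  BY-NAME EFFECT ON THE WALL: NONE.  NE7b NOT PRINTED ∕ NOT PROVED; spine PROVED 0∕9; rung (B)+1 — the
programme's measures remain FINITE-torus statements; NOT the mass gap, NOT Clay.  HONEST DEPENDENCY: continuum YM on T⁴ ⇐ BetaPertH ∧ nine
spine estimates (0∕9 proved); BetaPertH ⇐ (D1) ∧ (D4) ∧ CAP+tail; G-an2-4 gates asym, D1 and NE2∕3∕4.
-/

set_option autoImplicit false
set_option maxSynthPendingDepth 2

noncomputable section

namespace Summit.QuantumFields.BalabanUV.T4Continuum.NE7b.SupWhitenedSixthMoment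

open MeasureTheory ProbabilityTheory Real Set Function Finset Matrix
open scoped BigOperators
open Literature.Probability.Distributions (matrixCLM)
open SupWhitenedObservableSixthMoment (obs_sixth_moment_le sixth_pow_sub_le)
open SupWhitenedPoincareLetters (whitened_obs_hasFDerivAt whitened_obs_moments)
open SupWhitenedMomentLetters (op_letter_nonneg whitened_exp_integrable posSemidef_AAT)
open SupWhitenedCovarianceKernelLetter (whitened_tilted_eq_gauss whitened_integrable_lebesgue whitened_integrable_iff)
open SupGaussianRegulator (integrable_exp_half_sq_on)
open SupBlockEffectiveActionDerivative (neg_block_le)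
open SupRegulatedActivityShift (sum_add_sq_le)
open SupEffectiveActionDerivative (mul_opBound_le_of_le)

variable {ι κ : Type} [Fintype ι] [DecidableEq ι] [Fintype κ] [DecidableEq κ]

variable {U : EuclideanSpace ℝ ι → ℝ} {U' : EuclideanSpace ℝ ι → EuclideanSpace ℝ ι →L[ℝ] ℝ}
  {U'' : EuclideanSpace ℝ ι → EuclideanSpace ℝ ι →L[ℝ] EuclideanSpace ℝ ι →L[ℝ] ℝ} {A : Matrix ι κ ℝ} {γop κ₀ κ₁ κ₂ a τ δ θ lam : ℝ}

/-! ## §1. The raw tilted sixth moment of `‖U′‖` is finite -/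

/-- `S⁶ ≤ (45∕4)δ⁻⁶·e^{2δS}` for `δ > 0`, `S ≥ 0` (from `x⁶∕6! ≤ eˣ`). [folklore] -/
theorem pow6_le_exp {δ S : ℝ} (hδ : 0 < δ) (hS : 0 ≤ S) : S ^ 6 ≤ 45 / 4 * (δ ^ 6)⁻¹ * exp (2 * δ * S) := by
  have h := Real.pow_div_factorial_le_exp (x := 2 * δ * S) (by positivity) 6
  have e6 : ((Nat.factorial 6 : ℕ) : ℝ) = 720 := by norm_num [Nat.factorial]
  rw [e6] at h
  have e : (2 * δ * S) ^ 6 = 64 * (δ ^ 6 * S ^ 6) := by ring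
  rw [e] at h
  have hd6 : 0 < δ ^ 6 := pow_pos hδ 6
  have key : δ ^ 6 * S ^ 6 ≤ 45 / 4 * exp (2 * δ * S) := by linarith
  calc S ^ 6 = (δ ^ 6)⁻¹ * (δ ^ 6 * S ^ 6) := by rw [← mul_assoc, inv_mul_cancel₀ hd6.ne', one_mul]
    _ ≤ (δ ^ 6)⁻¹ * (45 / 4 * exp (2 * δ * S)) := mul_le_mul_of_nonneg_left key (inv_nonneg.2 hd6.le)
    _ = 45 / 4 * (δ ^ 6)⁻¹ * exp (2 * δ * S) := by ring

omit [DecidableEq ι] in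
/-- **The sixth tilted-moment integrand is under the common dominator**: `e^{−U(ω+ψ)}‖U′(ω+ψ)‖⁶ ≤ K₆(ψ)·e^{½(2κ₀(1+τ)+4δ)Σ_Yω²}`,
`K₆ = κ₁⁶(32(a+2Σ_Yψ²)⁶ + 23040δ⁻⁶)e^{κ₀(1+τ⁻¹)Σ_Yψ²}`. [folklore] -/
theorem block_moment6_pointwise (Y : Finset ι) (hκ₀ : 0 ≤ κ₀) (hκ₁ : 0 ≤ κ₁) (ha : 0 ≤ a) (hτ : 0 < τ) (hδ : 0 < δ)
    (hstab : ∀ φ : EuclideanSpace ℝ ι, -(κ₀ * ∑ x ∈ Y, φ x ^ 2) ≤ U φ)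
    (hU'b : ∀ φ : EuclideanSpace ℝ ι, ‖U' φ‖ ≤ κ₁ * (a + ∑ x ∈ Y, φ x ^ 2)) (ψ ω : EuclideanSpace ℝ ι) :
    exp (-U (ω + ψ)) * ‖U' (ω + ψ)‖ ^ 6 ≤ (κ₁ ^ 6 * (32 * (a + 2 * (∑ x ∈ Y, ψ x ^ 2)) ^ 6 + 23040 * (δ ^ 6)⁻¹) *
        exp (κ₀ * (1 + τ⁻¹) * (∑ x ∈ Y, ψ x ^ 2))) * exp ((2 * κ₀ * (1 + τ) + 4 * δ) * (∑ x ∈ Y, ω x ^ 2) / 2) := by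
  set S : ℝ := (∑ x ∈ Y, ψ x ^ 2) with hS
  set Sω : ℝ := ∑ x ∈ Y, ω x ^ 2 with hSω
  have hS0 : 0 ≤ S := sum_nonneg fun x _ => sq_nonneg _
  have hSω0 : 0 ≤ Sω := sum_nonneg fun x _ => sq_nonneg _
  set c : ℝ := a + 2 * S with hc
  have hc0 : 0 ≤ c := by rw [hc]; positivity
  have hV : -U (ω + ψ) ≤ κ₀ * (1 + τ) * Sω + κ₀ * (1 + τ⁻¹) * S := neg_block_le Y hκ₀ hτ hstab ω ψ
  have hsum : ∑ x ∈ Y, (ω + ψ) x ^ 2 ≤ 2 * Sω + 2 * S := by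
    have h := sum_add_sq_le Y (fun x => ω x) (fun x => ψ x) one_pos
    have e : ∑ x ∈ Y, (ω + ψ) x ^ 2 = ∑ x ∈ Y, (ω x + ψ x) ^ 2 := sum_congr rfl fun x _ => by simp
    rw [e]; norm_num at h; linarith
  have hD : ‖U' (ω + ψ)‖ ≤ κ₁ * (c + 2 * Sω) := by
    refine (hU'b (ω + ψ)).trans (mul_le_mul_of_nonneg_left ?_ hκ₁)
    rw [hc]; linarith
  have hq0 : 0 ≤ c + 2 * Sω := by positivity
  have hn6 : ‖U' (ω + ψ)‖ ^ 6 ≤ κ₁ ^ 6 * (c + 2 * Sω) ^ 6 := by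
    have h := pow_le_pow_left₀ (norm_nonneg _) hD 6
    rw [mul_pow] at h; exact h
  have he1 : 1 ≤ exp (2 * δ * Sω) := one_le_exp (by positivity)
  have hq6 : (c + 2 * Sω) ^ 6 ≤ (32 * c ^ 6 + 23040 * (δ ^ 6)⁻¹) * exp (2 * δ * Sω) := by
    have h1 : (c + 2 * Sω) ^ 6 ≤ 32 * (c ^ 6 + (2 * Sω) ^ 6) := by
      have h := sixth_pow_sub_le c (-(2 * Sω))
      rw [sub_neg_eq_add, Even.neg_pow ⟨3, rfl⟩] at h
      exact h
    have h2 := pow6_le_exp hδ hSω0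
    have h4 : c ^ 6 ≤ c ^ 6 * exp (2 * δ * Sω) := le_mul_of_one_le_right (pow_nonneg hc0 6) he1
    have e64 : (2 * Sω) ^ 6 = 64 * Sω ^ 6 := by ring
    rw [e64] at h1
    nlinarith [pow_nonneg hc0 6, (pow_pos hδ 6).le, inv_nonneg.2 (pow_pos hδ 6).le, (exp_pos (2 * δ * Sω)).le]
  have he : exp (κ₀ * (1 + τ) * Sω + κ₀ * (1 + τ⁻¹) * S) * exp (2 * δ * Sω) = exp (κ₀ * (1 + τ⁻¹) * S) * exp ((2 * κ₀ * (1 + τ) + 4 * δ) * Sω / 2) :=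
      by
    rw [← exp_add, ← exp_add]; congr 1; ring
  calc exp (-U (ω + ψ)) * ‖U' (ω + ψ)‖ ^ 6
      ≤ exp (κ₀ * (1 + τ) * Sω + κ₀ * (1 + τ⁻¹) * S) * (κ₁ ^ 6 * ((32 * c ^ 6 + 23040 * (δ ^ 6)⁻¹) * exp (2 * δ * Sω))) :=
        mul_le_mul (exp_le_exp.2 hV) (hn6.trans (mul_le_mul_of_nonneg_left hq6 (pow_nonneg hκ₁ 6))) (pow_nonneg (norm_nonneg _) 6) (exp_pos _).le
    _ = κ₁ ^ 6 * (32 * c ^ 6 + 23040 * (δ ^ 6)⁻¹) * exp (κ₀ * (1 + τ⁻¹) * S) * exp ((2 * κ₀ * (1 + τ) + 4 * δ) * Sω / 2) := by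
        calc _ = κ₁ ^ 6 * (32 * c ^ 6 + 23040 * (δ ^ 6)⁻¹) * (exp (κ₀ * (1 + τ) * Sω + κ₀ * (1 + τ⁻¹) * S) * exp (2 * δ * Sω)) := by ring
          _ = _ := by rw [he]; ring

/-- **The raw tilted sixth moment of `‖U′‖` is finite** at every background, for any `Γ ⪰ 0` under the regulator (domination by the Gaussian
regulator, as (423) for the fourth). [folklore] -/
theorem integrable_block_moment6 {Γ : Matrix ι ι ℝ} (hΓ : Γ.PosSemidef) (hΓop : (γop • (1 : Matrix ι ι ℝ) - Γ).PosSemidef) (Y : Finset ι)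
    (hUd : ∀ φ : EuclideanSpace ℝ ι, HasFDerivAt U (U' φ) φ) (hU'c : Continuous U')
    (hκ₀ : 0 ≤ κ₀) (hκ₁ : 0 ≤ κ₁) (ha : 0 ≤ a) (hτ : 0 < τ) (hδ : 0 < δ) (hθ1 : θ < 1)
    (hκθ : (2 * κ₀ * (1 + τ) + 4 * δ) * γop ≤ θ) (hstab : ∀ φ : EuclideanSpace ℝ ι, -(κ₀ * ∑ x ∈ Y, φ x ^ 2) ≤ U φ)
    (hU'b : ∀ φ : EuclideanSpace ℝ ι, ‖U' φ‖ ≤ κ₁ * (a + ∑ x ∈ Y, φ x ^ 2)) (ψ : EuclideanSpace ℝ ι) :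
    Integrable (fun ω : EuclideanSpace ℝ ι => exp (-U (ω + ψ)) * ‖U' (ω + ψ)‖ ^ 6) (multivariateGaussian 0 Γ) := by
  have hUc : Continuous U := continuous_iff_continuousAt.2 fun φ => (hUd φ).continuousAt
  have hsh : Continuous fun ω : EuclideanSpace ℝ ι => ω + ψ := continuous_id.add continuous_const
  have hEc : Continuous fun ω : EuclideanSpace ℝ ι => exp (-U (ω + ψ)) := continuous_exp.comp ((hUc.comp hsh).neg)
  have hNc : Continuous fun ω : EuclideanSpace ℝ ι => ‖U' (ω + ψ)‖ := continuous_norm.comp (hU'c.comp hsh)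
  have hdom := integrable_exp_half_sq_on hΓ hΓop (show 0 ≤ 2 * κ₀ * (1 + τ) + 4 * δ by positivity) hθ1 hκθ Y
  refine (hdom.const_mul (κ₁ ^ 6 * (32 * (a + 2 * (∑ x ∈ Y, ψ x ^ 2)) ^ 6 + 23040 * (δ ^ 6)⁻¹) * exp (κ₀ * (1 + τ⁻¹) * (∑ x ∈ Y, ψ x ^ 2)))).mono'
    ((hEc.mul (hNc.pow 6)).aestronglyMeasurable) (ae_of_all _ fun ω => ?_)
  rw [Real.norm_eq_abs, abs_of_nonneg (mul_nonneg (exp_pos _).le (pow_nonneg (norm_nonneg _) 6))]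
  exact block_moment6_pointwise Y hκ₀ hκ₁ ha hτ hδ hstab hU'b ψ ω

/-! ## §2. The whitened coordinates and (461)'s Gibbs format -/

/-- **`e^{−U(Aξ+ψ)}·g_v(ξ)⁶ ∈ L¹(N(0,I_κ))`**, `g_v(ξ) = U′(Aξ+ψ)(e_v)` (pushforward of §1, `|U′(φ)e_v| ≤ ‖U′(φ)‖`). [folklore] -/
theorem whitened_obs_moment6 (hΓop : (γop • (1 : Matrix ι ι ℝ) - A * Aᵀ).PosSemidef) (Y : Finset ι)
    (hUd : ∀ φ : EuclideanSpace ℝ ι, HasFDerivAt U (U' φ) φ) (hU'd : ∀ φ : EuclideanSpace ℝ ι, HasFDerivAt U' (U'' φ) φ)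
    (hκ₀ : 0 ≤ κ₀) (hκ₁ : 0 ≤ κ₁) (ha : 0 ≤ a) (hτ : 0 < τ) (hδ : 0 < δ) (hθ1 : θ < 1) (hκθ : (2 * κ₀ * (1 + τ) + 4 * δ) * γop ≤ θ)
    (hstab : ∀ φ : EuclideanSpace ℝ ι, -(κ₀ * ∑ x ∈ Y, φ x ^ 2) ≤ U φ) (hU'b : ∀ φ : EuclideanSpace ℝ ι, ‖U' φ‖ ≤ κ₁ * (a + ∑ x ∈ Y, φ x ^ 2))
    (ψ : EuclideanSpace ℝ ι) (v : ι) :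
    Integrable (fun ξ : EuclideanSpace ℝ κ => exp (-U (matrixCLM A ξ + ψ)) * U' (matrixCLM A ξ + ψ) (EuclideanSpace.single v (1 : ℝ)) ^ 6)
        (multivariateGaussian 0 (1 : Matrix κ κ ℝ)) := by
  have hU'c : Continuous U' := continuous_iff_continuousAt.2 fun φ => (hU'd φ).continuousAt
  have hUc : Continuous U := continuous_iff_continuousAt.2 fun φ => (hUd φ).continuousAt
  have i6 := integrable_block_moment6 (posSemidef_AAT A) hΓop Y hUd hU'c hκ₀ hκ₁ ha hτ hδ hθ1 hκθ hstab hU'b ψ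
  have hsh : Continuous fun ω : EuclideanSpace ℝ ι => ω + ψ := continuous_id.add continuous_const
  have hEc : Continuous fun ω : EuclideanSpace ℝ ι => exp (-U (ω + ψ)) := continuous_exp.comp (hUc.comp hsh).neg
  have hgc : Continuous fun ω : EuclideanSpace ℝ ι => U' (ω + ψ) (EuclideanSpace.single v (1 : ℝ)) := (hU'c.comp hsh).clm_apply continuous_const
  have hb : ∀ ω : EuclideanSpace ℝ ι, |U' (ω + ψ) (EuclideanSpace.single v (1 : ℝ))| ≤ ‖U' (ω + ψ)‖ := fun ω => by
    have h := ContinuousLinearMap.le_opNorm (U' (ω + ψ)) (EuclideanSpace.single v (1 : ℝ))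
    rw [Real.norm_eq_abs] at h
    simpa using h
  have hω : Integrable (fun ω : EuclideanSpace ℝ ι => exp (-U (ω + ψ)) * |U' (ω + ψ) (EuclideanSpace.single v (1 : ℝ))| ^ 6) (multivariateGaussian 0
      (A * Aᵀ)) :=
    i6.mono' ((hEc.mul ((continuous_abs.comp hgc).pow 6)).aestronglyMeasurable) (ae_of_all _ fun ω => by
      rw [Real.norm_eq_abs, abs_of_nonneg (mul_nonneg (exp_pos _).le (pow_nonneg (abs_nonneg _) 6))]
      exact mul_le_mul_of_nonneg_left (pow_le_pow_left₀ (abs_nonneg _) (hb ω) 6) (exp_pos _).le)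
  have hm : AEStronglyMeasurable (fun ω : EuclideanSpace ℝ ι => exp (-U (ω + ψ)) * |U' (ω + ψ) (EuclideanSpace.single v (1 : ℝ))| ^ 6)
      (multivariateGaussian 0 (A * Aᵀ)) := (hEc.mul ((continuous_abs.comp hgc).pow 6)).aestronglyMeasurable
  have k6 := (whitened_integrable_iff A hm).1 hω
  exact k6.congr (ae_of_all _ fun ξ => by
    dsimp only
    rw [← abs_pow, abs_of_nonneg (by positivity)])

/-- **`(F_v − c)⁶ ∈ L¹(ν)`** for every constant `c`, `F_v(z) = U′(A toLp z + ψ)(e_v)`, `ν ∝ e^{−V}dz`, `V(z) = ½z·z + U(A toLp z + ψ)` — the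
hypothesis `hI6` of (497)–(499). [folklore] -/
theorem whitened_sixth_power_integrable (hΓop : (γop • (1 : Matrix ι ι ℝ) - A * Aᵀ).PosSemidef) (Y : Finset ι)
    (hUd : ∀ φ : EuclideanSpace ℝ ι, HasFDerivAt U (U' φ) φ) (hU'd : ∀ φ : EuclideanSpace ℝ ι, HasFDerivAt U' (U'' φ) φ)
    (hκ₀ : 0 ≤ κ₀) (hκ₁ : 0 ≤ κ₁) (ha : 0 ≤ a) (hτ : 0 < τ) (hδ : 0 < δ) (hθ0 : 0 < θ) (hθ1 : θ < 1) (hκθ : (2 * κ₀ * (1 + τ) + 4 * δ) * γop ≤ θ)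
    (hstab : ∀ φ : EuclideanSpace ℝ ι, -(κ₀ * ∑ x ∈ Y, φ x ^ 2) ≤ U φ) (hU'b : ∀ φ : EuclideanSpace ℝ ι, ‖U' φ‖ ≤ κ₁ * (a + ∑ x ∈ Y, φ x ^ 2))
    (ψ : EuclideanSpace ℝ ι) (v : ι) (c : ℝ) :
    Integrable (fun z : κ → ℝ => (U' (matrixCLM A (WithLp.toLp 2 z) + ψ) (EuclideanSpace.single v (1 : ℝ)) - c) ^ 6)
      ((volume : Measure (κ → ℝ)).tilted fun z => -(1 / 2 * (z ⬝ᵥ z) + U (matrixCLM A (WithLp.toLp 2 z) + ψ))) := by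
  have hUc : Continuous U := continuous_iff_continuousAt.2 fun φ => (hUd φ).continuousAt
  have hU'c : Continuous U' := continuous_iff_continuousAt.2 fun φ => (hU'd φ).continuousAt
  have hκθ₀ : 2 * κ₀ * (1 + τ) * γop ≤ θ := mul_opBound_le_of_le (by positivity) (by linarith) hθ0.le hκθ
  have hI := whitened_exp_integrable hΓop Y hUc.measurable hκ₀ hτ hθ1 hκθ₀ hstab ψ
  have k6 := whitened_obs_moment6 hΓop Y hUd hU'd hκ₀ hκ₁ ha hτ hδ hθ1 hκθ hstab hU'b ψ v
  have hsh : Continuous fun ξ : EuclideanSpace ℝ κ => matrixCLM A ξ + ψ := (matrixCLM A).continuous.add continuous_const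
  have hgc : Continuous fun ξ : EuclideanSpace ℝ κ => U' (matrixCLM A ξ + ψ) (EuclideanSpace.single v (1 : ℝ)) :=
    (hU'c.comp hsh).clm_apply continuous_const
  have hEc : Continuous fun ξ : EuclideanSpace ℝ κ => exp (-U (matrixCLM A ξ + ψ)) := continuous_exp.comp ((hUc.comp hsh).neg)
  -- `e·(g − c)⁶ ≤ 32·e·g⁶ + 32c⁶·e` is integrable under `N(0,I)`
  have ig6 : Integrable (fun ξ : EuclideanSpace ℝ κ => exp (-U (matrixCLM A ξ + ψ)) * (U' (matrixCLM A ξ + ψ) (EuclideanSpace.single v (1 : ℝ)) - c)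
      ^ 6) (multivariateGaussian 0 (1 : Matrix κ κ ℝ)) := by
    refine ((k6.const_mul 32).add (hI.const_mul (32 * c ^ 6))).mono' ((hEc.mul ((hgc.sub continuous_const).pow 6)).aestronglyMeasurable)
      (ae_of_all _ fun ξ => ?_)
    rw [Real.norm_eq_abs, abs_of_nonneg (mul_nonneg (exp_pos _).le (by positivity)), Pi.add_apply]
    have h := mul_le_mul_of_nonneg_left (sixth_pow_sub_le (U' (matrixCLM A ξ + ψ) (EuclideanSpace.single v (1 : ℝ))) c) (exp_pos (-U (matrixCLM A ξ +
        ψ))).le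
    linarith
  -- transfer to Lebesgue and then to the tilted law
  have hL := whitened_integrable_lebesgue A ψ (k := fun ξ : EuclideanSpace ℝ κ => (U' (matrixCLM A ξ + ψ) (EuclideanSpace.single v (1 : ℝ)) - c) ^ 6)
      ig6
  have hV0 : Integrable (fun z : κ → ℝ => exp (-(1 / 2 * (z ⬝ᵥ z) + U (matrixCLM A (WithLp.toLp 2 z) + ψ)))) := by
    have h := whitened_integrable_lebesgue A ψ (k := fun _ => (1 : ℝ)) (by simpa only [mul_one] using hI)
    simpa only [one_mul] using h
  rw [integrable_tilted_iff hV0]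
  refine hL.congr (ae_of_all _ fun z => ?_)
  simp only [smul_eq_mul]
  ring

/-- **THE SIXTH CENTRED MOMENT IN (461)'s FORMAT**: `∫(F_v − E_νF_v)⁶dν ≤ 50κ₂⁶γ_op³∕(1 − λγ_op)³` — the hypothesis `hM6` of (497)–(499)
with `M₆ = 50κ₂⁶γ_op³∕(1−λγ_op)³`; uniform in the background, the site and the volume. [folklore] -/
theorem whitened_sixth_moment_gibbs [Nonempty ι] (hΓop : (γop • (1 : Matrix ι ι ℝ) - A * Aᵀ).PosSemidef) (Y : Finset ι)
    (hUd : ∀ φ : EuclideanSpace ℝ ι, HasFDerivAt U (U' φ) φ) (hU'd : ∀ φ : EuclideanSpace ℝ ι, HasFDerivAt U' (U'' φ) φ)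
    (hU''c : Continuous U'') (hκ₀ : 0 ≤ κ₀) (hκ₁ : 0 ≤ κ₁) (ha : 0 ≤ a) (hτ : 0 < τ) (hδ : 0 < δ) (hθ0 : 0 < θ) (hθ1 : θ < 1)
    (hκθ : (2 * κ₀ * (1 + τ) + 4 * δ) * γop ≤ θ) (hstab : ∀ φ : EuclideanSpace ℝ ι, -(κ₀ * ∑ x ∈ Y, φ x ^ 2) ≤ U φ)
    (hU'b : ∀ φ : EuclideanSpace ℝ ι, ‖U' φ‖ ≤ κ₁ * (a + ∑ x ∈ Y, φ x ^ 2)) (hU''b : ∀ φ : EuclideanSpace ℝ ι, ‖U'' φ‖ ≤ κ₂) (hlam : 0 ≤ lam)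
    (hUsec : ∀ s : ℝ, 0 ≤ s → s ≤ 1 → ∀ a b : EuclideanSpace ℝ ι,
      U ((1 - s) • a + s • b) - lam / 2 * (s * (1 - s)) * ∑ i, (a i - b i) ^ 2 ≤ (1 - s) * U a + s * U b)
    (hρ : lam * γop < 1) (ψ : EuclideanSpace ℝ ι) (v : ι) :
    ∫ z, (U' (matrixCLM A (WithLp.toLp 2 z) + ψ) (EuclideanSpace.single v (1 : ℝ)) -
          ∫ z', U' (matrixCLM A (WithLp.toLp 2 z') + ψ) (EuclideanSpace.single v (1 : ℝ))
            ∂((volume : Measure (κ → ℝ)).tilted fun z => -(1 / 2 * (z ⬝ᵥ z) + U (matrixCLM A (WithLp.toLp 2 z) + ψ)))) ^ 6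
        ∂((volume : Measure (κ → ℝ)).tilted fun z => -(1 / 2 * (z ⬝ᵥ z) + U (matrixCLM A (WithLp.toLp 2 z) + ψ))) ≤
      50 * (κ₂ ^ 6 * γop ^ 3) / (1 - lam * γop) ^ 3 := by
  have hγ := op_letter_nonneg hΓop
  have hκθ₀ : 2 * κ₀ * (1 + τ) * γop ≤ θ := mul_opBound_le_of_le (by positivity) (by linarith) hθ0.le hκθ
  obtain ⟨hgd, hg'c, hg'b⟩ := whitened_obs_hasFDerivAt hΓop hU'd hU''c hU''b ψ v
  obtain ⟨k1, k2, -, k4⟩ := whitened_obs_moments hΓop Y hUd hU'd hκ₀ hκ₁ ha hτ hδ hθ1 hκθ hstab hU'b ψ v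
  have k6 := whitened_obs_moment6 hΓop Y hUd hU'd hκ₀ hκ₁ ha hτ hδ hθ1 hκθ hstab hU'b ψ v
  have h := obs_sixth_moment_le hΓop Y hUd hκ₀ hτ hθ1 hκθ₀ hstab hlam hUsec hρ ψ hgd hg'c hg'b k1 k2 k4 k6
  have hL6 : (κ₂ * Real.sqrt γop) ^ 6 = κ₂ ^ 6 * γop ^ 3 := by
    have h2 : Real.sqrt γop ^ 2 = γop := Real.sq_sqrt hγ
    calc (κ₂ * Real.sqrt γop) ^ 6 = κ₂ ^ 6 * (Real.sqrt γop ^ 2) ^ 3 := by ring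
      _ = κ₂ ^ 6 * γop ^ 3 := by rw [h2]
  rw [hL6] at h
  rw [whitened_tilted_eq_gauss A ψ, whitened_tilted_eq_gauss A ψ]
  simp only [WithLp.toLp_ofLp]
  rw [div_eq_inv_mul, div_eq_inv_mul]
  exact h

/-! ## §3. Toy -/

/-- Toy (`x⁶∕6! ≤ eˣ` at `x = 0`): `0 ≤ 45∕4·1·e⁰`. -/
example : (0 : ℝ) ^ 6 ≤ 45 / 4 * ((1 : ℝ) ^ 6)⁻¹ * exp (2 * 1 * 0) := by norm_num

end Summit.QuantumFields.BalabanUV.T4Continuum.NE7b.SupWhitenedSixthMoment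

end
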